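import Mathlib
import HarnessLib

/-!
# Crux `TypeIliouvilleNoTypeII` (stmt-NavierStokesRegularity-0056), line `Sketch`
  (gradient-bkm-pivot): STUB `stub_threeFifthsLaw` — the kinematic 3/5 law (gradient form)

Lands `--supports stmt-NavierStokesRegularity-0056` the registered stub `stub_threeFifthsLaw` of
the lead's skeleton: there is an absolute constant `C > 0` such that every differentiable
square-integrable field `v : ℝ³ → ℝ³` with `‖∇v‖ ≤ L` everywhere obeys
`‖v(x)‖ ≤ C (∫ ‖v‖²)^{1/5} L^{3/5}`.

Proof (elementary).  Write `a := ‖v x‖` and `ω := |B(0, 1)| > 0`.  By the mean value inequality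
`‖v y - v x‖ ≤ L ‖y - x‖`, so on a ball `B(x, r)` with `L r ≤ a` one has `‖v y‖ ≥ a - L r ≥ 0`,
whence `(a - L r)² · r³ ω ≤ ∫_{B(x, r)} ‖v‖² ≤ ∫ ‖v‖²` (`threeFifthsGrad_ball_estimate`, with
`|B(x, r)| = r³ ω`).  For `L > 0` the radius `r := a / (2 L)` gives `a⁵ ω / (32 L³) ≤ ∫ ‖v‖²`,
i.e. `a⁵ ≤ (32 / ω) (∫ ‖v‖²) L³`, and fifth roots give the law with `C := (32 / ω)^{1/5}`.  For
`L = 0` the same estimate on a ball of large radius forces `a = 0` (finite energy).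
-/

-- the summit and its single problem share the name (D-0017 nested layout)
set_option linter.dupNamespace false

noncomputable section

namespace Summit.NavierStokesRegularity.NavierStokesRegularity.Theorems.TypeIliouvilleNoTypeII.GradientPivot

open Set Function Filter Topology MeasureTheory Metric
open scoped NNReal ENNReal

/-- `ℝ³` (the lead's skeleton states the stub with this local notation; the gate matches the
header verbatim). -/
local notation "E3" => EuclideanSpace ℝ (Fin 3)

/-- Volume of a ball of `ℝ³` in terms of the unit ball, real form: `|B(x, r)| = r³ |B(0, 1)|`.
[folklore] -/
theorem threeFifthsGrad_volume_ball_toReal (x : E3) {r : ℝ} (hr : 0 ≤ r) :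
    (volume (ball x r)).toReal = r ^ 3 * (volume (ball (0 : E3) 1)).toReal := by
  rw [Measure.addHaar_ball volume x hr, finrank_euclideanSpace_fin, ENNReal.toReal_mul,
    ENNReal.toReal_ofReal (pow_nonneg hr 3)]

/-- The ball estimate behind the 3/5 law: if `v : ℝ³ → ℝ³` is differentiable with `‖∇v‖ ≤ L`
everywhere and `‖v‖²` is integrable, then for every radius `r > 0` with `L r ≤ ‖v x‖` one has
`(‖v x‖ - L r)² · r³ |B(0, 1)| ≤ ∫ ‖v‖²` (mean value inequality on the ball `B(x, r)`).
[folklore] -/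
theorem threeFifthsGrad_ball_estimate {v : E3 → E3} {L : ℝ} (hv : Differentiable ℝ v)
    (hint : Integrable (fun y => ‖v y‖ ^ 2) volume) (hgrad : ∀ x, ‖fderiv ℝ v x‖ ≤ L)
    (x : E3) {r : ℝ} (hr : 0 < r) (hLr : L * r ≤ ‖v x‖) :
    (‖v x‖ - L * r) ^ 2 * (r ^ 3 * (volume (ball (0 : E3) 1)).toReal) ≤ ∫ y, ‖v y‖ ^ 2 := by
  have hL : 0 ≤ L := (norm_nonneg _).trans (hgrad x)
  -- pointwise lower bound on the ball, by the mean value inequality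
  have hpt : ∀ y ∈ ball x r, (‖v x‖ - L * r) ^ 2 ≤ ‖v y‖ ^ 2 := by
    intro y hy
    have hmv : ‖v y - v x‖ ≤ L * ‖y - x‖ :=
      convex_univ.norm_image_sub_le_of_norm_fderiv_le (fun z _ => hv z) (fun z _ => hgrad z)
        (mem_univ x) (mem_univ y)
    have hdist : ‖y - x‖ < r := by rwa [mem_ball, dist_eq_norm] at hy
    have h1 : ‖v x‖ - L * r ≤ ‖v y‖ := by
      have h2 := norm_sub_norm_le (v x) (v y)
      rw [norm_sub_rev] at h2
      have h3 : L * ‖y - x‖ ≤ L * r := mul_le_mul_of_nonneg_left hdist.le hL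
      linarith
    exact pow_le_pow_left₀ (sub_nonneg.2 hLr) h1 2
  have hconst : ∫ _ in ball x r, (‖v x‖ - L * r) ^ 2 =
      (‖v x‖ - L * r) ^ 2 * (r ^ 3 * (volume (ball (0 : E3) 1)).toReal) := by
    rw [setIntegral_const, smul_eq_mul, measureReal_def, threeFifthsGrad_volume_ball_toReal x hr.le]
    ring
  calc (‖v x‖ - L * r) ^ 2 * (r ^ 3 * (volume (ball (0 : E3) 1)).toReal)
      = ∫ _ in ball x r, (‖v x‖ - L * r) ^ 2 := hconst.symm
    _ ≤ ∫ y in ball x r, ‖v y‖ ^ 2 :=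
        setIntegral_mono_on (integrableOn_const measure_ball_lt_top.ne) hint.integrableOn
          measurableSet_ball hpt
    _ ≤ ∫ y, ‖v y‖ ^ 2 := setIntegral_le_integral hint (Eventually.of_forall fun y => sq_nonneg ‖v y‖)

/-- STUB 2 — **The kinematic 3/5 law (gradient form).**  There is an absolute constant
`C` such that every differentiable square-integrable `v : ℝ³ → ℝ³` with `‖∇v‖ ≤ L` everywhere obeys
`‖v(x)‖ ≤ C (∫ ‖v‖²)^{1/5} L^{3/5}`: if `‖v(x)‖ = a > 0` then `‖v‖ ≥ a/2` on the ball
`B(x, a/(2L))`, so `∫‖v‖² ≥ (a/2)² |B(x, a/(2L))| = a⁵ |B(0, 1)|/(32 L³)`; here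
`C := (32 / |B(0, 1)|)^{1/5}`. [folklore] -/
theorem stub_threeFifthsLaw :
    ∃ C : ℝ, 0 < C ∧ ∀ (v : E3 → E3) (L : ℝ), Differentiable ℝ v → MemLp v 2 volume → 0 ≤ L →
      (∀ x, ‖fderiv ℝ v x‖ ≤ L) →
      ∀ x, ‖v x‖ ≤ C * (∫ y, ‖v y‖ ^ 2) ^ (1 / 5 : ℝ) * L ^ (3 / 5 : ℝ) := by
  -- `ω := |B(0, 1)| > 0`, `K := 32 / ω`, `C := K^{1/5}`
  set ω : ℝ := (volume (ball (0 : E3) 1)).toReal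
  have hω : 0 < ω :=
    ENNReal.toReal_pos (measure_ball_pos volume (0 : E3) one_pos).ne' measure_ball_lt_top.ne
  set K : ℝ := 32 / ω with hK_def
  have hK : 0 < K := div_pos (by norm_num) hω
  refine ⟨K ^ (1 / 5 : ℝ), Real.rpow_pos_of_pos hK _, fun v L hv hmem hL hgrad x => ?_⟩
  have hint : Integrable (fun y => ‖v y‖ ^ 2) volume :=
    (memLp_two_iff_integrable_sq_norm hmem.aestronglyMeasurable).1 hmem
  set E : ℝ := ∫ y, ‖v y‖ ^ 2
  have hE : 0 ≤ E := integral_nonneg fun y => sq_nonneg ‖v y‖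
  set a : ℝ := ‖v x‖
  have ha : 0 ≤ a := norm_nonneg _
  -- the ball estimate, in the abbreviations
  have hball : ∀ {r : ℝ}, 0 < r → L * r ≤ a → (a - L * r) ^ 2 * (r ^ 3 * ω) ≤ E :=
    fun hr hLr => threeFifthsGrad_ball_estimate hv hint hgrad x hr hLr
  clear_value ω K E a
  -- the key estimate `a⁵ ≤ K E L³`
  have key : a ^ 5 ≤ K * E * L ^ 3 := by
    rcases ha.eq_or_lt with h0 | hapos
    · rw [← h0, zero_pow (by norm_num)]
      exact mul_nonneg (mul_nonneg hK.le hE) (pow_nonneg hL 3)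
    rcases hL.eq_or_lt with hL0 | hLpos
    · -- `L = 0`: the ball estimate on a ball of large radius contradicts finite energy
      exfalso
      subst hL0
      have hR1 : 1 ≤ E / (ω * a ^ 2) + 1 := le_add_of_nonneg_left (div_nonneg hE (by positivity))
      have h : (a - 0 * (E / (ω * a ^ 2) + 1)) ^ 2 * ((E / (ω * a ^ 2) + 1) ^ 3 * ω) ≤ E :=
        hball (one_pos.trans_le hR1) (by rw [zero_mul]; exact ha)
      rw [zero_mul, sub_zero] at h
      have hR3 : E / (ω * a ^ 2) + 1 ≤ (E / (ω * a ^ 2) + 1) ^ 3 := le_self_pow₀ hR1 (by norm_num)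
      have h2 : a ^ 2 * ((E / (ω * a ^ 2) + 1) * ω) ≤ E :=
        le_trans (mul_le_mul_of_nonneg_left (mul_le_mul_of_nonneg_right hR3 hω.le) (sq_nonneg a)) h
      have h3 : a ^ 2 * ((E / (ω * a ^ 2) + 1) * ω) = E + a ^ 2 * ω := by
        field_simp
      have h4 : 0 < a ^ 2 * ω := mul_pos (pow_pos hapos 2) hω
      linarith
    · -- `L > 0`: the ball estimate at radius `r := a / (2 L)`
      have hLr : L * (a / (2 * L)) = a / 2 := by
        field_simp
      have h : (a - L * (a / (2 * L))) ^ 2 * ((a / (2 * L)) ^ 3 * ω) ≤ E :=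
        hball (by positivity) (by rw [hLr]; linarith)
      have h5 : (a - L * (a / (2 * L))) ^ 2 * ((a / (2 * L)) ^ 3 * ω) = a ^ 5 / (K * L ^ 3) := by
        rw [hLr, hK_def]
        field_simp
        ring
      rw [h5, div_le_iff₀ (by positivity)] at h
      exact h.trans_eq (by ring)
  -- fifth roots
  have hrhs : (K ^ (1 / 5 : ℝ) * E ^ (1 / 5 : ℝ) * L ^ (3 / 5 : ℝ)) ^ 5 = K * E * L ^ 3 := by
    rw [mul_pow, mul_pow, ← Real.rpow_mul_natCast hK.le, ← Real.rpow_mul_natCast hE,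
      ← Real.rpow_mul_natCast hL]
    norm_num
  exact le_of_pow_le_pow_left₀ (by norm_num) (by positivity) (key.trans_eq hrhs.symm)

end Summit.NavierStokesRegularity.NavierStokesRegularity.Theorems.TypeIliouvilleNoTypeII.GradientPivot

end
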